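import Summits.SmoothPoincare4.SmoothPoincare4.Theses.CongruenceShadows
import Summits.SmoothPoincare4.SmoothPoincare4.Theses.GroupTrisection
import Literature.Topology.FourManifolds.TrisectionFunctorSPC4
import Literature.Topology.FourManifolds.TrisectionEulerProofs
import Literature.Topology.FourManifolds.TrisectionFunctorGKVanKampen
import Literature.Topology.FourManifolds.FlowerMelon
import Literature.Topology.FourManifolds.TrisectionsProofs
import Literature.Topology.FourManifolds.TrisectionsBalancing
import Literature.Topology.FourManifolds.GroupTrisectionsConnectSum
import Literature.Topology.FourManifolds.SPC4Handles
import Literature.Topology.FourManifolds.LickorishWallace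

/-!
# Line `level-set-kirby-triple` for crux `AgkCor6Sufficiency` (stmt-SmoothPoincare4-10894)

Skeleton of the LEVEL-SET / KIRBY-TRIPLE line (crux idea `Ideas/level-set-kirby-triple.md`,
merged by triage r1 with `heegaard-kirby-shadow` and, as its stabilisation stub, with
`upstream-stabilisation`).

**Idea.**  Abrams–Gay–Kirby's functor `𝒢` is read on a trisection that COMES WITH ITS MORSE
FUNCTION: a *level datum* of a closed smooth `4`-manifold `M` is the tree's own Gay–Kirby
Lemma-14 construction data — a bi-collar `B : BiCollar M` (Morse function `f = B.f`, regular
level `a`, unit field, Heegaard function of the level) and sector data `T : B.TriData` (top level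
`c = T.c`, bevel, rounding) — whose sectors `T.sectors` form a `(g; κ)` Gay–Kirby trisection,
together with the Morse bookkeeping above the top level (`{f ≥ c}` = the `3`- and `4`-handles:
one critical point of index `4`, `κ 2` of index `3`, none of index `≤ 2`; indices `≤ 2` below `c`).
By construction `{f ≥ c} ⊆ T.sectors 2` (`LevelDatum.superlevel_subset_sectors_two`), so the
closed manifold splits SMOOTHLY along the level `f⁻¹(c)` into the `2`-handlebody `{f ≤ c}` and a
`1`-handlebody.  Rigidity ("`𝒢` isomorphic ⇒ diffeomorphic") is therefore cut as
TWO-HANDLEBODY RECOGNITION (`{f ≤ c} ≅ {f' ≤ c'}`, the hardest stub: Dehn–Nielsen–Baer on the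
central surface, handlebody-kernel extension over the three handlebodies, Laudenbach–Poénaru on
the first sector and on the `2`-handle block, straightening of the collar `T.sectors 2 ∩ {f ≤ c}`
by the flow of `B.U`) followed by REASSEMBLY along the smooth level by spc4.S24 ("a closed
`4`-manifold is determined by its `2`-handlebody", proved in the tree from Laudenbach–Poénaru):
no third sector is ever matched by hand and no triple corner along `F` is reassembled.

**Composition** (`AgkCor6Sufficiency_of`, kernel-checked, no `sorry`): the AGK hypothesis `X` is
applied TWICE — to the level datum of the homotopy sphere `M` and to a level datum of the round
`S⁴` — so that no realisation of the standard triple (leaf (d′)) is needed; the two sides are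
brought to the same genus WITHOUT Nielsen lifting of automorphisms of `S_g`: `M`'s datum is first
stabilised `m₀ + 1` times geometrically (stub `stub_levelStabilizeOne`, one slot at a time, kernels
re-marked ON THE NOSE by `exists_marking_groupGKTrisectionOf_eq`), the genus equation of
`IsStablyTrivial` then forces `m ≥ m₀`, and `S⁴`'s datum is stabilised `m - m₀` further times on
the nose (`stabilizeIter_add`, `cast_cast` of `Theorems/AgkCor6Sufficiency/Negative/DownwardClosed.lean`).
Balance of the data is obtained from the one-slot stub by `TrisectionBalancing.exists_balanced_of_stabilize`;
the group-trisection axioms are the tree's discharged (a′)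
`isGroupTrisection_groupGKTrisectionOf_holds`; markings by the discharged (g′).

**Stubs** (registered; `sorry` only here): `stub_levelDatum_exists` (E₀: Gay–Kirby Thm. 4 /
Lemma 14 exported WITH its level data — the tree's `exists_isGKTrisection` threads it internally),
`stub_levelStabilizeOne` (S: upstream one-slot stabilisation by a `(1,2)`-birth / Heegaard
stabilisation / `(2,3)`-birth, kernels `≅ stabilizeOne i`), `stub_dehnNielsenBaer` (based
Dehn–Nielsen–Baer between marked central surfaces), `stub_handlebodyKernelExtension` (a boundary
diffeomorphism of genus-`g` handlebodies carrying kernel to kernel extends), `stub_laudenbachPoenaru`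
(the tree's named fact `exists_diffeomorph_comp_incl_eq`, shared with route NoOneHandles and the
crux ideas `lp-by-sphere-system-surgery` / `lp-by-minimal-heegaard-splitting`),
`stub_twoHandlebodyRecognition` (HARDEST), `stub_twoHandlebodyReassembly` (spc4.S24 along `f⁻¹(c)`).

**Disproof.lean honoured (cycles 1–2).**  No `_false_without_` theorem exists beyond
`AgkCor6SufficiencyWithoutHyp = SPC4`; the line uses the hypothesis `X` (twice, at
`AgkCor6Sufficiency_of`), only on `(3k, k)` triples of the trivial group (tightness
`isStablyTrivial_tight`; the refuted strengthenings `not_agkHypothesisUnbalanced`,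
`not_agkHypothesisAnyGroup` and the truncations `AgkCor6SufficiencyUpTo` of §9 are never
instantiated); §7 `stabilizeIter_add` is used positively; the cycle-2 §10 tree gap
(`Iso K K' → Iso K.stabilize K'.stabilize` only modulo Nielsen lifting) is circumvented — no `Iso`
is ever pushed through a stabilisation here; §8's load-bearing instance `RigidityVsSphere` is where
R1 + R2 are consumed.
-/

noncomputable section

set_option linter.dupNamespace false

open Set
open scoped Manifold ContDiff ContinuousMap

namespace Summit.SmoothPoincare4.SmoothPoincare4.Cruxes.AgkCor6Sufficiency.LevelSetKirbyTriple

open Literature.Topology.FourManifolds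

local notation "𝕊⁴" => (Metric.sphere (0 : EuclideanSpace ℝ (Fin 5)) 1)

/-! ## Cast bookkeeping for kernel triples

Self-contained copies of the (proved, landed) lemmas of
`Theorems/AgkCor6Sufficiency/Negative/StablyTrivialTight.lean` and `…/Negative/DownwardClosed.lean`
(`Disproof.lean` §2, §7), kept here so that the skeleton elaborates without importing them. -/

namespace Cast

variable {g : ℕ}

/-- Transport along an equality of genera preserves the trisection property. -/
theorem isGroupTrisection_cast {g' k : ℕ} {G : Type*} [Group G] {K : TrisectionKernels g}
    (hK : IsGroupTrisection g k G K) (h : g = g') : IsGroupTrisection g' k G (K.cast h) := by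
  subst h
  exact hK

/-- Transport does not change stable triviality. -/
theorem isStablyTrivial_cast_iff {g' : ℕ} (K : TrisectionKernels g) (h : g = g') :
    (K.cast h).IsStablyTrivial ↔ K.IsStablyTrivial := by
  subst h
  rfl

/-- Transport of a transport. -/
theorem cast_cast {g' g'' : ℕ} (K : TrisectionKernels g) (h : g = g') (h' : g' = g'') :
    (K.cast h).cast h' = K.cast (h.trans h') := by
  subst h; subst h'; rfl

/-- Stabilisation commutes with transport. -/
theorem stabilize_cast {g' : ℕ} (K : TrisectionKernels g) (h : g = g') :
    (K.cast h).stabilize = K.stabilize.cast (by rw [h]) := by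
  subst h; rfl

/-- Iterated stabilisation commutes with transport. -/
theorem stabilizeIter_cast {g' : ℕ} (K : TrisectionKernels g) (h : g = g') (n : ℕ) :
    (K.cast h).stabilizeIter n = (K.stabilizeIter n).cast (by rw [h]) := by
  subst h; rfl

/-- `Iso` is transport-invariant (both sides). -/
theorem iso_cast_iff {g' : ℕ} (h : g = g') (A B : TrisectionKernels g) :
    TrisectionKernels.Iso (A.cast h) (B.cast h) ↔ TrisectionKernels.Iso A B := by
  subst h; rfl

/-- Stabilising `a` times and then `b` times is stabilising `a + b` times (up to transport). -/
theorem stabilizeIter_add (K : TrisectionKernels g) (a : ℕ) :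
    ∀ b : ℕ, (K.stabilizeIter a).stabilizeIter b = (K.stabilizeIter (a + b)).cast (by omega)
  | 0 => rfl
  | b + 1 => by
    show ((K.stabilizeIter a).stabilizeIter b).stabilize = (K.stabilizeIter (a + b)).stabilize.cast _
    rw [stabilizeIter_add K a b, stabilize_cast]

end Cast

/-! ## The level datum (bundle of existing tree declarations, no new geometry) -/

/-- **Level datum of type `(g; κ)` on a closed smooth `4`-manifold `M`**: the tree's
Gay–Kirby Lemma-14 data (`BiCollar`, `TriData`) whose sectors form a `(g; κ 0, κ 1, κ 2)`
Gay–Kirby trisection, plus the Morse bookkeeping of `f = B.f` relative to the top level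
`c = T.c`: below `c` all critical points have index `≤ 2` (so `{f ≤ c}` is the `2`-handlebody),
above `c` there are exactly one critical point of index `4`, `κ 2` of index `3` and none of index
`≤ 2` (so `{f ≥ c} ≅ ♮^{κ 2} S¹ × B³` is the `3`- and `4`-handles).  Markings of the central
surface are NOT part of the datum. -/
structure LevelDatum (M : Type) [TopologicalSpace M] [T2Space M] [SecondCountableTopology M]
    [CompactSpace M] [ChartedSpace (EuclideanSpace ℝ (Fin 4)) M] [IsManifold (𝓡 4) ∞ M]
    (g : ℕ) (κ : Fin 3 → ℕ) where
  /-- The bi-collar: Morse function `f`, regular level `a`, unit field `U`, Heegaard function `g`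
  of the level, its regular value `b`, unit field `V`. -/
  B : BiCollar M
  /-- The sector data over `B`: Morse frame, bevel of the first sector, top level `c`, rounding
  width `ε`. -/
  T : B.TriData
  /-- The three sectors `![X₁, X₂, X₃]` of the construction are a `(g; κ)` Gay–Kirby trisection. -/
  isGKTrisection : IsGKTrisection M g κ T.sectors
  /-- Below the top level every critical point of `f` has index `≤ 2`. -/
  morseIndex_le_two_of_lt_top :
    ∀ p, IsMCriticalPt (𝓡 4) B.f p → B.f p < T.c → morseIndex (𝓡 4) B.f p ≤ 2
  /-- Above the top level there is no critical point of index `≤ 2`. -/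
  ncard_top_of_le_two :
    ∀ i, i ≤ 2 → (criticalSetOfIndex (𝓡 4) B.f i ∩ B.f ⁻¹' Set.Ioi T.c).ncard = 0
  /-- Above the top level there are exactly `κ 2` critical points of index `3`. -/
  ncard_top_three : (criticalSetOfIndex (𝓡 4) B.f 3 ∩ B.f ⁻¹' Set.Ioi T.c).ncard = κ 2
  /-- Above the top level there is exactly one critical point of index `4`. -/
  ncard_top_four : (criticalSetOfIndex (𝓡 4) B.f 4 ∩ B.f ⁻¹' Set.Ioi T.c).ncard = 1

namespace LevelDatum

variable {M : Type} [TopologicalSpace M] [T2Space M] [SecondCountableTopology M]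
  [CompactSpace M] [ChartedSpace (EuclideanSpace ℝ (Fin 4)) M] [IsManifold (𝓡 4) ∞ M]
  {g : ℕ} {κ : Fin 3 → ℕ}

/-- **The Kirby triple of a level datum** read through a based marking `(x₀, μ)` of the central
surface: Abrams–Gay–Kirby's `𝒢` of the construction's trisection (`groupGKTrisectionOf`). -/
def kernels (d : LevelDatum M g κ) (x₀ : centralSurface d.T.sectors)
    (μ : SurfaceGroup g ≃* FundamentalGroup (centralSurface d.T.sectors) x₀) :
    TrisectionKernels g :=
  groupGKTrisectionOf d.isGKTrisection x₀ μ

/-- Unfolding of `kernels`. -/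
theorem kernels_eq (d : LevelDatum M g κ) (x₀ : centralSurface d.T.sectors)
    (μ : SurfaceGroup g ≃* FundamentalGroup (centralSurface d.T.sectors) x₀) :
    d.kernels x₀ μ = groupGKTrisectionOf d.isGKTrisection x₀ μ := rfl

/-- Re-marking: any kernel triple isomorphic to the Kirby triple of a level datum IS its Kirby
triple for another marking at the same base point (`exists_marking_groupGKTrisectionOf_eq`). -/
theorem exists_marking_eq (d : LevelDatum M g κ) (x₀ : centralSurface d.T.sectors)
    (μ : SurfaceGroup g ≃* FundamentalGroup (centralSurface d.T.sectors) x₀)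
    {K : TrisectionKernels g} (h : TrisectionKernels.Iso (d.kernels x₀ μ) K) :
    ∃ μ' : SurfaceGroup g ≃* FundamentalGroup (centralSurface d.T.sectors) x₀, d.kernels x₀ μ' = K :=
  exists_marking_groupGKTrisectionOf_eq d.isGKTrisection x₀ μ h

/-- The top level `c` is a regular level of `f` (no critical point on it, `T.regular_c`). -/
theorem regularTop (d : LevelDatum M g κ) : IsRegularLevel (𝓡 4) d.B.f d.T.c :=
  ⟨d.T.Fr.isMorse.contMDiff, fun _ _ => BoundarylessManifold.isInteriorPoint,
    fun x hx => d.T.regular_c x hx⟩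

/-- **The `2`-handlebody `{f ≤ c}` of a level datum**, a compact smooth `4`-manifold with
boundary the level `f⁻¹(c)` (`RegularSublevel`). -/
abbrev TwoHandlebody (d : LevelDatum M g κ) : Type := RegularSublevel d.regularTop

/-- The level structure at the top: the superlevel set `{f ≥ c}` (the `3`- and `4`-handles) lies
in the third sector, by the very definition `X₃ = closure S₃ ∪ {f ≥ c}` of the construction. -/
theorem superlevel_subset_sectors_two (d : LevelDatum M g κ) :
    {x | d.T.c ≤ d.B.f x} ⊆ d.T.sectors 2 := by
  intro x hx
  rw [BiCollar.TriData.sectors_two]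
  exact Set.mem_union_right _ hx

end LevelDatum

/-! ## The stub statements -/

/-- **(E₀) Level data exist** (Gay–Kirby 2016, Thm. 4 via §4, Lemma 14, in the form the tree's
construction `exists_isGKTrisection` actually produces before forgetting the data): every closed
connected smooth `4`-manifold carries a level datum of some type `(g; κ)`. -/
def LevelDatumExists : Prop :=
  ∀ (M : Type) [TopologicalSpace M] [T2Space M] [SecondCountableTopology M] [CompactSpace M]
    [ChartedSpace (EuclideanSpace ℝ (Fin 4)) M] [IsManifold (𝓡 4) ∞ M] [ConnectedSpace M],
    ∃ (g : ℕ) (κ : Fin 3 → ℕ), Nonempty (LevelDatum M g κ)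

/-- **(S) Upstream one-slot stabilisation** (Gay–Kirby 2016, Def. 8 / Lemma 10 and p. 3114;
Meier–Schirmer–Zupan 2016, Def. 3.7; Abrams–Gay–Kirby 2018, Def. 3 and Thm. 5 "connected sums
of group trisections map to connected sums of 4-manifold trisections"): a level datum of type
`(g; κ)` can be replaced by one of type `(g + 1; κ + e_i)` — a cancelling `(1,2)`-birth pair, a
stabilisation of the Heegaard splitting of the level, or a cancelling `(2,3)`-birth pair in a
ball, according to the slot `i` — whose Kirby triple is, for a suitable marking, isomorphic to the
unbalanced algebraic stabilisation `stabilizeOne i` of the old one (for every marking of the old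
datum). -/
def LevelStabilizeOne : Prop :=
  ∀ (M : Type) [TopologicalSpace M] [T2Space M] [SecondCountableTopology M] [CompactSpace M]
    [ChartedSpace (EuclideanSpace ℝ (Fin 4)) M] [IsManifold (𝓡 4) ∞ M] [ConnectedSpace M]
    (_ : SmoothOrientation (𝓡 4) M) (g : ℕ) (κ : Fin 3 → ℕ) (d : LevelDatum M g κ) (i : Fin 3),
    ∃ d' : LevelDatum M (g + 1) (Function.update κ i (κ i + 1)),
      ∀ (x₀ : centralSurface d.T.sectors)
        (μ : SurfaceGroup g ≃* FundamentalGroup (centralSurface d.T.sectors) x₀),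
        ∃ (x₀' : centralSurface d'.T.sectors)
          (μ' : SurfaceGroup (g + 1) ≃* FundamentalGroup (centralSurface d'.T.sectors) x₀'),
          TrisectionKernels.Iso (d'.kernels x₀' μ') ((d.kernels x₀ μ).stabilizeOne i)

/-- **(DNB) Based Dehn–Nielsen–Baer between marked central surfaces** (Nielsen 1927; Baer 1928;
Zieschang–Vogt–Coldewey 1980, Thm. 5.6.2; Farb–Margalit, Thm. 8.1 with the Birman sequence for
the based form): for two Gay–Kirby trisections of the same genus `g` (of closed connected oriented
smooth `4`-manifolds) with based markings `μ, μ'` of their central surfaces and any automorphism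
`α` of `S_g`, some based homeomorphism of the central surfaces induces `μ' ∘ α ∘ μ⁻¹` on `π₁`. -/
def DehnNielsenBaerGK : Prop :=
  ∀ (X : Type) [TopologicalSpace X] [T2Space X] [SecondCountableTopology X] [CompactSpace X]
    [ChartedSpace (EuclideanSpace ℝ (Fin 4)) X] [IsManifold (𝓡 4) ∞ X] [ConnectedSpace X]
    (_ : SmoothOrientation (𝓡 4) X)
    (X' : Type) [TopologicalSpace X'] [T2Space X'] [SecondCountableTopology X'] [CompactSpace X']
    [ChartedSpace (EuclideanSpace ℝ (Fin 4)) X'] [IsManifold (𝓡 4) ∞ X'] [ConnectedSpace X']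
    (_ : SmoothOrientation (𝓡 4) X')
    (g : ℕ) (κ κ' : Fin 3 → ℕ) (S : Fin 3 → Set X) (S' : Fin 3 → Set X')
    (_ : IsGKTrisection X g κ S) (_ : IsGKTrisection X' g κ' S')
    (x₀ : centralSurface S) (x₀' : centralSurface S')
    (μ : SurfaceGroup g ≃* FundamentalGroup (centralSurface S) x₀)
    (μ' : SurfaceGroup g ≃* FundamentalGroup (centralSurface S') x₀')
    (α : SurfaceGroup g ≃* SurfaceGroup g),
    ∃ (ψ : centralSurface S ≃ₜ centralSurface S') (hψ : ψ x₀ = x₀'),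
      ∀ γ : SurfaceGroup g,
        FundamentalGroup.mapOfEq (⟨ψ, ψ.continuous⟩ : C(centralSurface S, centralSurface S')) hψ (μ γ)
          = μ' (α γ)

/-- **(HKE) Handlebody-kernel extension** (Griffiths 1964; Zieschang; folklore via meridian discs,
Dehn's lemma for handlebodies and Alexander's theorem): a diffeomorphism between the boundaries of
two genus-`g` handlebodies that carries the kernel of `π₁(∂H) → π₁(H)` onto the kernel of
`π₁(∂H') → π₁(H')` extends to a diffeomorphism of the handlebodies. -/
def HandlebodyKernelExtension : Prop :=
  ∀ (g : ℕ) (H : Type) [TopologicalSpace H] [T2Space H] [SecondCountableTopology H]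
    [ChartedSpace (EuclideanHalfSpace 3) H] [IsManifold (𝓡∂ 3) ∞ H]
    (H' : Type) [TopologicalSpace H'] [T2Space H'] [SecondCountableTopology H']
    [ChartedSpace (EuclideanHalfSpace 3) H'] [IsManifold (𝓡∂ 3) ∞ H']
    (_ : IsHandlebody g H) (_ : IsHandlebody g H')
    (b : BoundaryData (𝓡∂ 3) H (𝓡 2)) (b' : BoundaryData (𝓡∂ 3) H' (𝓡 2))
    (φ : b.carrier ≃ₘ⟮𝓡 2, 𝓡 2⟯ b'.carrier) (x₀ : b.carrier),
    ((FundamentalGroup.map (⟨b.incl, b.continuous_incl⟩ : C(b.carrier, H)) x₀).ker).map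
        (FundamentalGroup.map (⟨φ, φ.continuous⟩ : C(b.carrier, b'.carrier)) x₀)
      = (FundamentalGroup.map (⟨b'.incl, b'.continuous_incl⟩ : C(b'.carrier, H'))
          ((⟨φ, φ.continuous⟩ : C(b.carrier, b'.carrier)) x₀)).ker →
    ∃ Φ : H ≃ₘ⟮𝓡∂ 3, 𝓡∂ 3⟯ H', ⇑Φ ∘ b.incl = b'.incl ∘ ⇑φ

/-- **(R1) Two-handlebody recognition — the hardest stub.**  Two closed connected oriented smooth
`4`-manifolds carrying level data of the same type whose Kirby triples are isomorphic have
diffeomorphic `2`-handlebodies `{f ≤ c} ≅ {f' ≤ c'}` (Gay–Kirby 2016, §4: "the spine determines a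
neighbourhood", restricted to `X₁ ∪ X₂` and the collar over `H₃₁`; Laudenbach–Poénaru on `X₁` and
on the `2`-handle block `X₂ = H₁₂ × I ∪ 2-handles`; Kepplinger 2022, §2). -/
def TwoHandlebodyRecognition : Prop :=
  ∀ (M : Type) [TopologicalSpace M] [T2Space M] [SecondCountableTopology M] [CompactSpace M]
    [ChartedSpace (EuclideanSpace ℝ (Fin 4)) M] [IsManifold (𝓡 4) ∞ M] [ConnectedSpace M]
    (_ : SmoothOrientation (𝓡 4) M)
    (M' : Type) [TopologicalSpace M'] [T2Space M'] [SecondCountableTopology M'] [CompactSpace M']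
    [ChartedSpace (EuclideanSpace ℝ (Fin 4)) M'] [IsManifold (𝓡 4) ∞ M'] [ConnectedSpace M']
    (_ : SmoothOrientation (𝓡 4) M')
    (g : ℕ) (κ : Fin 3 → ℕ) (d : LevelDatum M g κ) (d' : LevelDatum M' g κ)
    (x₀ : centralSurface d.T.sectors) (μ : SurfaceGroup g ≃* FundamentalGroup (centralSurface d.T.sectors) x₀)
    (x₀' : centralSurface d'.T.sectors) (μ' : SurfaceGroup g ≃* FundamentalGroup (centralSurface d'.T.sectors) x₀'),
    TrisectionKernels.Iso (d.kernels x₀ μ) (d'.kernels x₀' μ') →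
      Nonempty (d.TwoHandlebody ≃ₘ⟮𝓡∂ 4, 𝓡∂ 4⟯ d'.TwoHandlebody)

/-- **(R2) Reassembly along the smooth top level** (spc4.S24, second half: a closed `4`-manifold is
determined by its `2`-handlebody — Matsumoto 2001, Lemma 5.20; Kirby 1989, Ch. I §2, p. 8 — the
tree's `nonempty_diffeomorph_of_isBoundaryGluing_twoHandlebody`, proved from Laudenbach–Poénaru):
for level data of the same type, a diffeomorphism of the `2`-handlebodies `{f ≤ c}` yields a
diffeomorphism of the closed manifolds (`M = {f ≤ c} ∪_{f⁻¹(c)} {f ≥ c}`,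
`RegularSublevel.isBoundaryGluing_split`, and `{f ≥ c} ≅ ♮^{κ 2} S¹ × B³`). -/
def TwoHandlebodyReassembly : Prop :=
  ∀ (M : Type) [TopologicalSpace M] [T2Space M] [SecondCountableTopology M] [CompactSpace M]
    [ChartedSpace (EuclideanSpace ℝ (Fin 4)) M] [IsManifold (𝓡 4) ∞ M] [ConnectedSpace M]
    (_ : SmoothOrientation (𝓡 4) M)
    (M' : Type) [TopologicalSpace M'] [T2Space M'] [SecondCountableTopology M'] [CompactSpace M']
    [ChartedSpace (EuclideanSpace ℝ (Fin 4)) M'] [IsManifold (𝓡 4) ∞ M'] [ConnectedSpace M']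
    (_ : SmoothOrientation (𝓡 4) M')
    (g : ℕ) (κ : Fin 3 → ℕ) (d : LevelDatum M g κ) (d' : LevelDatum M' g κ),
    Nonempty (d.TwoHandlebody ≃ₘ⟮𝓡∂ 4, 𝓡∂ 4⟯ d'.TwoHandlebody) → Nonempty (M ≃ₘ⟮𝓡 4, 𝓡 4⟯ M')

/-! ## The registered stubs -/

/-- **stub (E₀)**: level data exist (export of the tree's Gay–Kirby Lemma-14 construction). -/
theorem stub_levelDatum_exists : LevelDatumExists := by
  sorry

/-- **stub (S)**: upstream one-slot stabilisation with kernels `≅ stabilizeOne i`. -/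
theorem stub_levelStabilizeOne : LevelStabilizeOne := by
  sorry

/-- **stub (DNB)**: based Dehn–Nielsen–Baer between marked central surfaces. -/
theorem stub_dehnNielsenBaer : DehnNielsenBaerGK := by
  sorry

/-- **stub (HKE)**: handlebody-kernel extension. -/
theorem stub_handlebodyKernelExtension : HandlebodyKernelExtension := by
  sorry

/-- **stub (LP)**: the Laudenbach–Poénaru extension theorem, the tree's named fact
`exists_diffeomorph_comp_incl_eq` (fact seat shared with route NoOneHandles; crux ideas
`lp-by-sphere-system-surgery`, `lp-by-minimal-heegaard-splitting` are its two discharge plans). -/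
theorem stub_laudenbachPoenaru : exists_diffeomorph_comp_incl_eq.{0} := by
  sorry

/-- **stub (R1, hardest)**: two-handlebody recognition from Laudenbach–Poénaru, Dehn–Nielsen–Baer
and handlebody-kernel extension. -/
theorem stub_twoHandlebodyRecognition :
    exists_diffeomorph_comp_incl_eq.{0} → DehnNielsenBaerGK → HandlebodyKernelExtension →
      TwoHandlebodyRecognition := by
  sorry

/-- **stub (R2)**: reassembly along the top level from Laudenbach–Poénaru (spc4.S24). -/
theorem stub_twoHandlebodyReassembly :
    exists_diffeomorph_comp_incl_eq.{0} → TwoHandlebodyReassembly := by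
  sorry

/-! ## The composition (no `sorry` below this line) -/

section Composition

variable {M : Type} [TopologicalSpace M] [T2Space M] [SecondCountableTopology M]
  [CompactSpace M] [ChartedSpace (EuclideanSpace ℝ (Fin 4)) M] [IsManifold (𝓡 4) ∞ M]

/-- **Balanced level data** from (E₀) and the one-slot stabilisation (S), by
`TrisectionBalancing.exists_balanced_of_stabilize` (kernels not tracked at this stage). -/
theorem exists_levelDatum_balanced (hE : LevelDatumExists) (hS : LevelStabilizeOne)
    [ConnectedSpace M] (o : SmoothOrientation (𝓡 4) M) :
    ∃ g k : ℕ, Nonempty (LevelDatum M g (fun _ => k)) := by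
  obtain ⟨g, κ, ⟨d⟩⟩ := hE M
  have hstab : ∀ (g : ℕ) (κ : Fin 3 → ℕ) (i : Fin 3), Nonempty (LevelDatum M g κ) →
      Nonempty (LevelDatum M (g + 1) (Function.update κ i (κ i + 1))) := by
    rintro g κ i ⟨d⟩
    obtain ⟨d', -⟩ := hS M o g κ d i
    exact ⟨d'⟩
  obtain ⟨g', k', -, h⟩ :=
    TrisectionBalancing.exists_balanced_of_stabilize (P := fun g κ => Nonempty (LevelDatum M g κ))
      hstab ⟨d⟩
  exact ⟨g', k', h⟩

/-- **One full stabilisation round ON THE NOSE** from three one-slot stabilisations (slots `2`,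
`1`, `0`), re-marking after each step (`LevelDatum.exists_marking_eq`) and
`TrisectionKernels.stabilize_eq_stabilizeOne`; no lifting of automorphisms of `S_g` is involved. -/
theorem exists_levelDatum_stabilize (hS : LevelStabilizeOne) [ConnectedSpace M]
    (o : SmoothOrientation (𝓡 4) M) {g k : ℕ} (d : LevelDatum M g (fun _ => k))
    (x₀ : centralSurface d.T.sectors)
    (μ : SurfaceGroup g ≃* FundamentalGroup (centralSurface d.T.sectors) x₀) :
    ∃ (d' : LevelDatum M (g + 3) (fun _ => k + 1)) (x₀' : centralSurface d'.T.sectors)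
      (μ' : SurfaceGroup (g + 3) ≃* FundamentalGroup (centralSurface d'.T.sectors) x₀'),
      d'.kernels x₀' μ' = (d.kernels x₀ μ).stabilize := by
  -- slot 2
  obtain ⟨d₁, h₁⟩ := hS M o g _ d 2
  obtain ⟨x₁, μ₁, iso₁⟩ := h₁ x₀ μ
  obtain ⟨ν₁, hν₁⟩ := d₁.exists_marking_eq x₁ μ₁ iso₁
  -- slot 1
  obtain ⟨d₂, h₂⟩ := hS M o (g + 1) _ d₁ 1
  obtain ⟨x₂, μ₂, iso₂⟩ := h₂ x₁ ν₁
  rw [hν₁] at iso₂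
  obtain ⟨ν₂, hν₂⟩ := d₂.exists_marking_eq x₂ μ₂ iso₂
  -- slot 0
  obtain ⟨d₃, h₃⟩ := hS M o (g + 1 + 1) _ d₂ 0
  obtain ⟨x₃, μ₃, iso₃⟩ := h₃ x₂ ν₂
  rw [hν₂] at iso₃
  obtain ⟨ν₃, hν₃⟩ := d₃.exists_marking_eq x₃ μ₃ iso₃
  -- transport the index function to the constant `k + 1`
  have key : ∀ (κ₃ : Fin 3 → ℕ), κ₃ = (fun _ => k + 1) →
      ∀ (d₃ : LevelDatum M (g + 3) κ₃) (x₃ : centralSurface d₃.T.sectors)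
        (ν₃ : SurfaceGroup (g + 3) ≃* FundamentalGroup (centralSurface d₃.T.sectors) x₃),
        d₃.kernels x₃ ν₃ = (d.kernels x₀ μ).stabilize →
        ∃ (d' : LevelDatum M (g + 3) (fun _ => k + 1)) (x₀' : centralSurface d'.T.sectors)
          (μ' : SurfaceGroup (g + 3) ≃* FundamentalGroup (centralSurface d'.T.sectors) x₀'),
          d'.kernels x₀' μ' = (d.kernels x₀ μ).stabilize := by
    rintro κ₃ rfl d₃ x₃ ν₃ h
    exact ⟨d₃, x₃, ν₃, h⟩
  refine key _ ?_ d₃ x₃ ν₃ ?_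
  · funext i
    fin_cases i <;> simp
  · rw [TrisectionKernels.stabilize_eq_stabilizeOne]
    exact hν₃

/-- **Iterated stabilisation on the nose**: `n` rounds realise `stabilizeIter n` literally. -/
theorem exists_levelDatum_stabilizeIter (hS : LevelStabilizeOne) [ConnectedSpace M]
    (o : SmoothOrientation (𝓡 4) M) {g k : ℕ} (d : LevelDatum M g (fun _ => k))
    (x₀ : centralSurface d.T.sectors)
    (μ : SurfaceGroup g ≃* FundamentalGroup (centralSurface d.T.sectors) x₀) (n : ℕ) :
    ∃ (d' : LevelDatum M (g + 3 * n) (fun _ => k + n)) (x₀' : centralSurface d'.T.sectors)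
      (μ' : SurfaceGroup (g + 3 * n) ≃* FundamentalGroup (centralSurface d'.T.sectors) x₀'),
      d'.kernels x₀' μ' = (d.kernels x₀ μ).stabilizeIter n := by
  induction n with
  | zero => exact ⟨d, x₀, μ, rfl⟩
  | succ n ih =>
    obtain ⟨dₙ, xₙ, μₙ, hₙ⟩ := ih
    obtain ⟨d', x', μ', h'⟩ := exists_levelDatum_stabilize hS o dₙ xₙ μₙ
    refine ⟨d', x', μ', ?_⟩
    show d'.kernels x' μ' = ((d.kernels x₀ μ).stabilizeIter n).stabilize
    rw [h', hₙ]

/-- Recognition and reassembly with the genus and the type transported along equalities of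
natural numbers (eliminated by `subst`). -/
theorem nonempty_diffeomorph_of_iso_cast (hRec : TwoHandlebodyRecognition)
    (hAsm : TwoHandlebodyReassembly) [ConnectedSpace M] (o : SmoothOrientation (𝓡 4) M)
    {M' : Type} [TopologicalSpace M'] [T2Space M'] [SecondCountableTopology M'] [CompactSpace M']
    [ChartedSpace (EuclideanSpace ℝ (Fin 4)) M'] [IsManifold (𝓡 4) ∞ M'] [ConnectedSpace M']
    (o' : SmoothOrientation (𝓡 4) M') {g g' : ℕ} {κ κ' : Fin 3 → ℕ} (hg : g = g') (hκ : κ = κ')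
    (d : LevelDatum M g κ) (d' : LevelDatum M' g' κ')
    (x₀ : centralSurface d.T.sectors) (μ : SurfaceGroup g ≃* FundamentalGroup (centralSurface d.T.sectors) x₀)
    (x₀' : centralSurface d'.T.sectors) (μ' : SurfaceGroup g' ≃* FundamentalGroup (centralSurface d'.T.sectors) x₀')
    (h : TrisectionKernels.Iso ((d.kernels x₀ μ).cast hg) (d'.kernels x₀' μ')) :
    Nonempty (M ≃ₘ⟮𝓡 4, 𝓡 4⟯ M') := by
  subst hg
  subst hκ
  rw [TrisectionKernels.cast_rfl] at h
  exact hAsm M o M' o' g κ d d' (hRec M o M' o' g κ d d' x₀ μ x₀' μ' h)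

end Composition

/-! ## Name-keyed aliases of the seven stub statements (the hypotheses of the composition)

`__Registered.stub_X` is the statement of `stub_X` under the registered stub's short name, so that
the native skeleton audit (`#h21_check_skeleton`: a by-name skeleton theorem may take only
registered obligations / declared stubs as hypotheses, matched BY NAME) accepts
`AgkCor6Sufficiency_of : __Registered.stub_… → … → AgkCor6Sufficiency` (device of the sibling line
`lp-by-minimal-heegaard-splitting`).  `agkCor6Sufficiency_skeleton` applies the composition to the
seven `stub_…` literally, which checks that statements, aliases and stubs agree. -/
namespace __Registered

/-- Alias of the statement of `stub_levelDatum_exists`. -/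
abbrev stub_levelDatum_exists : Prop := LevelDatumExists
/-- Alias of the statement of `stub_levelStabilizeOne`. -/
abbrev stub_levelStabilizeOne : Prop := LevelStabilizeOne
/-- Alias of the statement of `stub_dehnNielsenBaer`. -/
abbrev stub_dehnNielsenBaer : Prop := DehnNielsenBaerGK
/-- Alias of the statement of `stub_handlebodyKernelExtension`. -/
abbrev stub_handlebodyKernelExtension : Prop := HandlebodyKernelExtension
/-- Alias of the statement of `stub_laudenbachPoenaru`. -/
abbrev stub_laudenbachPoenaru : Prop := exists_diffeomorph_comp_incl_eq.{0}
/-- Alias of the statement of `stub_twoHandlebodyRecognition`. -/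
abbrev stub_twoHandlebodyRecognition : Prop :=
  exists_diffeomorph_comp_incl_eq.{0} → DehnNielsenBaerGK → HandlebodyKernelExtension →
    TwoHandlebodyRecognition
/-- Alias of the statement of `stub_twoHandlebodyReassembly`. -/
abbrev stub_twoHandlebodyReassembly : Prop :=
  exists_diffeomorph_comp_incl_eq.{0} → TwoHandlebodyReassembly

end __Registered

/-- **The crux from the stubs.**  Abrams–Gay–Kirby Cor. 6 ⇐ along level sets: the hypothesis
`X` is applied to the Kirby triple of a level datum of the homotopy sphere `M` (stabilised
`m₀ + 1` times first) and to that of a level datum of the round `S⁴`; both stable trivialities are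
realised ON THE NOSE by upstream stabilisations, the two data land in the same type
`(3 + 3m; m + 1)` with isomorphic Kirby triples, recognition gives `{f ≤ c} ≅ {f_S ≤ c_S}` and
reassembly along the top level gives `M ≅ S⁴`. -/
theorem AgkCor6Sufficiency_of (hE : __Registered.stub_levelDatum_exists)
    (hS : __Registered.stub_levelStabilizeOne) (hDNB : __Registered.stub_dehnNielsenBaer)
    (hHKE : __Registered.stub_handlebodyKernelExtension) (hLP : __Registered.stub_laudenbachPoenaru)
    (hR1 : __Registered.stub_twoHandlebodyRecognition)
    (hR2 : __Registered.stub_twoHandlebodyReassembly) :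
    Summit.SmoothPoincare4.SmoothPoincare4.Theses.CongruenceShadows.AgkCor6Sufficiency := by
  have hRec : TwoHandlebodyRecognition := hR1 hLP hDNB hHKE
  have hAsm : TwoHandlebodyReassembly := hR2 hLP
  intro hX M _ _ _ _ _ e
  -- packaging of `M ≃ₕ S⁴` (all proved in the tree)
  haveI : CompactSpace M := compactSpace_of_homotopyEquiv_sphere_four_holds M e
  obtain ⟨o⟩ := isOrientable_of_homotopyEquiv_sphere_four_holds M e
  haveI : SimplyConnectedSpace 𝕊⁴ := simplyConnectedSpace_sphere_four_holds
  haveI : SimplyConnectedSpace M := e.simplyConnectedSpace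
  obtain ⟨o'⟩ := isOrientable_sphere_holds 4
  -- balanced level data on both sides; `χ = 2` forces the genus to be `3k`
  obtain ⟨G, k, ⟨d₀⟩⟩ := exists_levelDatum_balanced hE hS o
  obtain ⟨G', k', ⟨e₀⟩⟩ := exists_levelDatum_balanced hE hS o'
  obtain rfl : G = 3 * k :=
    gkTrisection_genus_eq_sum_of_homotopyEquiv_sphere_holds.balanced M o d₀.isGKTrisection e
  obtain rfl : G' = 3 * k' :=
    gkTrisection_genus_eq_sum_of_homotopyEquiv_sphere_holds.balanced 𝕊⁴ o' e₀.isGKTrisection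
      (ContinuousMap.HomotopyEquiv.refl 𝕊⁴)
  -- markings (discharged (g′))
  obtain ⟨x₀, ⟨μ⟩⟩ :=
    exists_marking_centralSurface_of_gkTrisection_holds M o (3 * k) k d₀.T.sectors d₀.isGKTrisection
  obtain ⟨y₀, ⟨ν⟩⟩ :=
    exists_marking_centralSurface_of_gkTrisection_holds 𝕊⁴ o' (3 * k') k' e₀.T.sectors e₀.isGKTrisection
  -- `S⁴` side: the hypothesis on the Kirby triple of `e₀` (a `(3k', k')` trisection of `1`, (a′))
  have hK' : IsGroupTrisection (3 * k') k' (PUnit : Type) (e₀.kernels y₀ ν) :=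
    (isGroupTrisection_groupGKTrisectionOf_holds 𝕊⁴ o' (3 * k') k' e₀.T.sectors e₀.isGKTrisection
      y₀ ν).punit_of_subsingleton
  obtain ⟨n', m₀, e', iso'⟩ := hX k' _ hK'
  -- `M` side: stabilise `m₀ + 1` times first, then apply the hypothesis
  obtain ⟨d₁, x₁, μ₁, -⟩ := exists_levelDatum_stabilizeIter hS o d₀ x₀ μ (m₀ + 1)
  have hK₁ : IsGroupTrisection (3 * k + 3 * (m₀ + 1)) (k + (m₀ + 1)) (PUnit : Type)
      (d₁.kernels x₁ μ₁) :=
    (isGroupTrisection_groupGKTrisectionOf_holds M o _ _ d₁.T.sectors d₁.isGKTrisection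
      x₁ μ₁).punit_of_subsingleton
  have eg : 3 * k + 3 * (m₀ + 1) = 3 * (k + (m₀ + 1)) := by ring
  have hst := hX (k + (m₀ + 1)) _
    (Cast.isGroupTrisection_cast hK₁ eg)
  rw [Cast.isStablyTrivial_cast_iff] at hst
  obtain ⟨n, m, hnm, iso⟩ := hst
  -- realise the `n` further stabilisations of `M`'s datum on the nose
  obtain ⟨dM, xM, μM, hdM⟩ := exists_levelDatum_stabilizeIter hS o d₁ x₁ μ₁ n
  -- `S⁴` side: realise `n'` stabilisations on the nose, re-mark to the standard triple,
  -- and stabilise `t = m - m₀` further times on the nose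
  obtain ⟨e₁, y₁, ν₁, he₁⟩ := exists_levelDatum_stabilizeIter hS o' e₀ y₀ ν n'
  rw [← he₁] at iso'
  obtain ⟨ν₁', hν₁'⟩ := e₁.exists_marking_eq y₁ ν₁ iso'
  obtain ⟨t, rfl⟩ : ∃ t, m = m₀ + t := ⟨m - m₀, by omega⟩
  obtain ⟨eS, yS, νS, heS⟩ := exists_levelDatum_stabilizeIter hS o' e₁ y₁ ν₁' t
  rw [hν₁', Cast.stabilizeIter_cast,
    Cast.stabilizeIter_add,
    Cast.cast_cast] at heS
  -- the two data have the same type `(3 + 3(m₀ + t); m₀ + t + 1)`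
  have hg : 3 * k + 3 * (m₀ + 1) + 3 * n = 3 * k' + 3 * n' + 3 * t := by omega
  have hκ : (fun _ : Fin 3 => k + (m₀ + 1) + n) = fun _ => k' + n' + t := by
    funext
    omega
  -- isomorphic Kirby triples, recognition, reassembly
  refine nonempty_diffeomorph_of_iso_cast hRec hAsm o o' hg hκ dM eS xM μM yS νS ?_
  have hiso := (Cast.iso_cast_iff hg _ _).2 iso
  rw [Cast.cast_cast] at hiso
  rw [hdM, heS]
  exact hiso

/-- The same composition, phrased against the shared decl of route `GroupTrisection` (identical
signature; the crux item stmt-SmoothPoincare4-10894 is wanted by both routes). -/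
theorem AgkCor6Sufficiency_of_groupTrisection (hE : __Registered.stub_levelDatum_exists)
    (hS : __Registered.stub_levelStabilizeOne) (hDNB : __Registered.stub_dehnNielsenBaer)
    (hHKE : __Registered.stub_handlebodyKernelExtension) (hLP : __Registered.stub_laudenbachPoenaru)
    (hR1 : __Registered.stub_twoHandlebodyRecognition)
    (hR2 : __Registered.stub_twoHandlebodyReassembly) :
    Summit.SmoothPoincare4.SmoothPoincare4.Theses.GroupTrisection.AgkCor6Sufficiency :=
  AgkCor6Sufficiency_of hE hS hDNB hHKE hLP hR1 hR2

/-- **The skeleton fed with the registered stubs literally** (checks that statements, aliases and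
stubs agree; `#print axioms` = the standard three + `sorryAx` from the seven stubs only; it closes
when they are proved). -/
theorem agkCor6Sufficiency_skeleton :
    Summit.SmoothPoincare4.SmoothPoincare4.Theses.CongruenceShadows.AgkCor6Sufficiency :=
  AgkCor6Sufficiency_of stub_levelDatum_exists stub_levelStabilizeOne stub_dehnNielsenBaer
    stub_handlebodyKernelExtension stub_laudenbachPoenaru stub_twoHandlebodyRecognition
    stub_twoHandlebodyReassembly

/-- Idem for the shared decl of route `GroupTrisection`. -/
theorem agkCor6Sufficiency_skeleton_groupTrisection :
    Summit.SmoothPoincare4.SmoothPoincare4.Theses.GroupTrisection.AgkCor6Sufficiency :=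
  AgkCor6Sufficiency_of_groupTrisection stub_levelDatum_exists stub_levelStabilizeOne
    stub_dehnNielsenBaer stub_handlebodyKernelExtension stub_laudenbachPoenaru
    stub_twoHandlebodyRecognition stub_twoHandlebodyReassembly

/-- **Unfolded form over the plain statements** (the item's signature verbatim, no aliases, no
route file needed to read it); not a skeleton candidate (its conclusion is not a name). -/
theorem agkCor6Sufficiency_of_statements :
    LevelDatumExists → LevelStabilizeOne → DehnNielsenBaerGK → HandlebodyKernelExtension →
    exists_diffeomorph_comp_incl_eq.{0} →
    (exists_diffeomorph_comp_incl_eq.{0} → DehnNielsenBaerGK → HandlebodyKernelExtension →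
      TwoHandlebodyRecognition) →
    (exists_diffeomorph_comp_incl_eq.{0} → TwoHandlebodyReassembly) →
    ((∀ (k : ℕ) (K : TrisectionKernels (3 * k)),
        IsGroupTrisection (3 * k) k (PUnit : Type) K → K.IsStablyTrivial) →
      ∀ (M : Type) [TopologicalSpace M] [T2Space M] [SecondCountableTopology M],
        ContinuousMap.HomotopyEquiv.NonemptyDiffeomorphSphere M 4) :=
  AgkCor6Sufficiency_of

end Summit.SmoothPoincare4.SmoothPoincare4.Cruxes.AgkCor6Sufficiency.LevelSetKirbyTriple

end
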